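import Summits.QuantumFields.BalabanUV.T4Continuum.Support.NE7RepWGaugeOfRoutePi
import Summits.QuantumFields.BalabanUV.T4Continuum.Support.NE7SoftDataPath
import HarnessLib

/-!
# NE7OneStepOfRoutePi — THE END OF GENERATION 69: ONE-STEP for all sufficiently small data ⇐ (APE) ∧ ROW NE3's PER-PAIR BINDER `hleaves`
# (the R-adapted residual slice representative + the weight with its local quadratic letter + currencies) on the data class `𝒟_β` —
# the normal sizes `ν`, `κ₁` of gen 67 ∕ 68's REP_w^gauge letter are DISCHARGED by row NE3's exact curved right inverse

Cell `pub-balaban`, rung (B)+1 sub-cell t4, lineage `b2b-balaban-t4-ne7-p1`, generation 69 (CRUX PROVER NE7 #1); hunt (h13), memo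
`t4/b2b-balaban-t4-ne7-p1-g69/HUNT-H13-ROUTE-PI-TRANSPOSED.md`.  File F31 (over F30 `NE7RepWGaugeOfRoutePi.hrep_of_hleaves` and F29
`NE7SoftDataPath.oneStep_of_dataClass_ape_repWgauge` ∕ `oneStep_SU2_of_dataClass_ape_repWgauge`).

WHAT ([folklore] composition; 0 def, 0 sorry).
§1 **`oneStep_of_dataClass_ape_routePi`** (generic `d`, `L ≥ 2`, every `N ≥ 1`): F29's END with its REP_w^gauge binder `hrep` REPLACED by
   (a) the uniform W6 regime of row NE3's right inverse `thetaLoc d L·ε < 1`, `ε ≤ 1`; (b) the route-Π ceilings `α̂ ≤ 1`, `Ĉ`, the quadratic-letter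
   constant `C₂`, and TWO k-free numeric lines (`ν̂ < 1`, the strict CONV line for `ν̂∕(1−ν̂)`, `κ̂∕(1−ν̂)²`, `α̂`); (c) PER PAIR `(U♯, U′)` at every datum
   `D ∈ 𝒟_β = {unitary, N-periodic, SmallField ≤ 4(e^β − 1)}`, every level `k+1`, `U♯` admissible, `SmallField U♯ (δ₁M⁻²)`, tangent-critical, `U′`
   admissible: `∃ u X₀ α₀ m C` — `ResidualSliceRepT L N (k+1) U♯ U′ u X₀ (rightInvW …(dirIter L (k+1) U♯ X₀)) α₀` [B11 Prop. 2 ∕ B8 Thm 2 TYPE, row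
   NE3's leaf Π-L1♮ read at the pair], the weight `m ≥ 0` with `M^dΣm² ≤ C²dirSq X₀`, the local quadratic letter
   `‖dirIter L (k+1) U♯ X₀ (z,κ)‖ ≤ C₂(M·m(z,κ))²` [Π-C-3γ over (Π-REG-γ)], the currencies `α₀M ≤ α̂`, `mM ≤ α̂`, `C ≤ Ĉ`.
§2 **`oneStep_SU2_of_dataClass_ape_routePi`** — `d = 4`, `L = 2`, `card n = 2`, `0 < ε ≤ 10⁻⁵³`: (P♮)_W ∕ the level family ∕ class smallness ∕ `ε ≤ 1`
   discharged (F29 §4, F20's `levelSmall_all_d4_L2`) — THE END OF RECORD of generation 69.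
THE (A)-BILL AFTER THIS FILE: X-A4 ∧ (APE on 𝒟_β) ∧ (row NE3's `hleaves` on 𝒟_β at the pairs `(U♯, U′)`) ∧ k-free numeric lines — the SAME per-pair
binder as row NE3's local half (`NE3EnergyRateWSupRoutePiFinal`): ONE supplier (the gauge leaf Π-L1♮ + the path-sum quadratic letter over (Π-REG-γ))
serves BOTH rows.  GONE: the smooth lift and its sizes (theorems of row NE3: `NE3RightInverseLetters`, `preSizes_of_letters`).
HONEST FRAMING (page 1).  Composition over HYPOTHESES; (APE) (B11 Sect. F TYPE), the residual slice representative (B11 Prop. 2 TYPE), the weight with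
its quadratic letter and the numeric lines are asserted for nothing; `γ` inexplicit (F29's compactness); NOT ONE-STEP, NOT NE7; spine 0∕9; finite T⁴
rung (B)+1 — NOT infinite volume, NOT mass gap, NOT Clay.  Continuum YM on T⁴ ⇐ BetaPertH ∧ nine spine estimates (0/9 proved); BetaPertH ⇐ (D1) ∧
(D4) ∧ CAP+tail; G-an2-4 gates asym, D1 and NE2/3/4.
-/

set_option autoImplicit false

open scoped BigOperators Matrix Matrix.Norms.L2Operator
open NormedSpace Finset Set

namespace Summit.QuantumFields.BalabanUV.T4Continuum.NE7OneStepOfRoutePi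

open Literature.MathematicalPhysics.QuantumFieldTheory.Balaban1983to89
open B7Prop1Explicit B7Prop2Explicit
open T4AveragingDeficitWall (IsUnitaryCfg IsSkewDir SmallField vary curl curlSq dirSq dirL1)
open T4AveragingDeficitWallBoundary (IsPeriodicCfg periodBox)
open AveragingDeficitPeriodicCounting (IsPeriodicDir)
open AveragingDeficitMultiLevelPrep (LevelSmall tower TangentIter)
open MinimalActionLevels (perWin)
open MinimalActionSandwich (IsMinimiser admissible)
open MinimalActionRate (sfClass)
open NE3HessForm (dAction)
open NE3SlicePoincareShape (SlicePoincare slicePoincare_mono)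
open NE3SlicePoincareBudgetLine (CPLine)
open NE3ClassRadiusFamily (classSlicePoincare_SU2' CPLine_nonneg_d4_L2)
open NE3FrameFreeSliceW (frameFreeBlockLandauW)
open NE3TangentCovariantTower (dirIter)
open NE3DecomposedRepOfLinearNormalPart (ResidualSliceRepT)
open NE3QbarIterCovLiftPrep (cruxC)
open NE3SmoothRightInverseW (rightInvW)
open NE3RightInverseSolveLetters (thetaLoc)
open NE3RightInverseL2Letter (l2C)
open NE3HatInvCurlLetters (curl2C curl1C)
open NE7ConvOneStepSU2 (levelSmall_all_d4_L2)
open NE7OneStepOfPathOpen (classSmall_d4_L2)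
open NE7SoftDataPath (oneStep_of_dataClass_ape_repWgauge)
open NE7RepWGaugeOfRoutePi (hrep_of_hleaves)

noncomputable section

variable {d : ℕ} {n : Type*} [Fintype n] [DecidableEq n]

/-! ## §1 The END over the data class with row NE3's per-pair binder -/

/-- **ONE-STEP FOR ALL SUFFICIENTLY SMALL DATA ⇐ (APE) ∧ ROW NE3's `hleaves` ON THE DATA CLASS `𝒟_β`** (generic `d`, `L ≥ 2`, every `N ≥ 1`; see the
module docstring §1 for the reading of every hypothesis).  `ν̂ = 2√(l2C∕(1−θℓ)² + curl2C∕(1−θℓ)²)·C₂·Ĉ·α̂`, `κ̂ = 4(curl1C∕(1−θℓ))·C₂·Ĉ²·ε`,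
`θℓ = thetaLoc d L·ε`. [folklore] -/
theorem oneStep_of_dataClass_ape_routePi [Nonempty n] {L N : ℕ} [NeZero L] [NeZero N] (hL : 2 ≤ L) (hN : 1 ≤ N) {ε δ δ₁ CP β : ℝ}
    (hε : 0 < ε) (hε1 : 16 * C0 d * ε ≤ 3) (hε2 : 1024 * (d + 1) * (d + 4) * (L : ℝ) ^ 2 * ε ≤ 1) (hδ₁ : 0 ≤ δ₁) (hδ₁δ : δ₁ < δ) (hδε : δ < ε)
    (hCP : 0 < CP) (hβ : 0 < β) (hls : ∀ k : ℕ, LevelSmall d L k (ε / ((L : ℝ) ^ (k + 1)) ^ 2))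
    (hP : ∀ (j : ℕ) (W' : Site d → Fin d → (Matrix n n ℂ)ˣ), W' ∈ sfClass d L N ε (j + 1) →
      SlicePoincare L (j + 1) W' (frameFreeBlockLandauW L N (j + 1) W') CP (periodBox (d := d) (N * L ^ (j + 1))))
    -- row NE3's right inverse regime (W6) and route Π's ceilings and two k-free lines
    (hθl : thetaLoc d L * ε < 1) (hε1' : ε ≤ 1) {C₂ αh Ch : ℝ} (hC₂ : 0 ≤ C₂) (hαh0 : 0 ≤ αh) (hαh1 : αh ≤ 1) (hCh0 : 0 ≤ Ch)
    {νh κh : ℝ} (hνh : νh = 2 * Real.sqrt (l2C d L / (1 - thetaLoc d L * ε) ^ 2 + curl2C d L / (1 - thetaLoc d L * ε) ^ 2) * C₂ * Ch * αh)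
    (hκh : κh = 4 * (curl1C d L / (1 - thetaLoc d L * ε)) * C₂ * Ch ^ 2 * ε) (hν : νh < 1)
    (hline : 2 * (κh / (1 - νh) ^ 2) < ((((1 / 2 - (νh / (1 - νh)) ^ 2) / (2 * (1 + CP)) - (νh / (1 - νh)) ^ 2) / 2
        - 576 * d * (αh ^ 2 * Real.exp (2 * αh))) / (Fintype.card n : ℝ) - 28 * d * (ε + 7 * αh ^ 2)))
    -- (APE) on the data class
    (hape : ∀ D : Site d → Fin d → (Matrix n n ℂ)ˣ, IsUnitaryCfg D → IsPeriodicCfg D (N : ℤ) → SmallField D (4 * (Real.exp β - 1)) →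
      ∀ (k : ℕ), ∀ U ∈ admissible (sfClass d L N ε) L (k + 1) D, SmallField U (δ / ((L : ℝ) ^ (k + 1)) ^ 2) →
      (∀ φ : Site d → Fin d → Matrix n n ℂ, IsSkewDir φ → IsPeriodicDir φ ((N * L ^ (k + 1) : ℕ) : ℤ) → TangentIter L k U φ →
        dAction U φ (perWin d (N * L ^ (k + 1))) = 0) → SmallField U (δ₁ / ((L : ℝ) ^ (k + 1)) ^ 2))
    -- ROW NE3's PER-PAIR BINDER on the data class, at the pairs (U♯, U′)
    (hleaves : ∀ D : Site d → Fin d → (Matrix n n ℂ)ˣ, IsUnitaryCfg D → IsPeriodicCfg D (N : ℤ) → SmallField D (4 * (Real.exp β - 1)) →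
      ∀ (k : ℕ), ∀ Us ∈ admissible (sfClass d L N ε) L (k + 1) D, SmallField Us (δ₁ / ((L : ℝ) ^ (k + 1)) ^ 2) →
      (∀ φ : Site d → Fin d → Matrix n n ℂ, IsSkewDir φ → IsPeriodicDir φ ((N * L ^ (k + 1) : ℕ) : ℤ) → TangentIter L k Us φ →
        dAction Us φ (perWin d (N * L ^ (k + 1))) = 0) →
      ∀ U' ∈ admissible (sfClass d L N ε) L (k + 1) D,
      ∃ (u : Site d → (Matrix n n ℂ)ˣ) (X₀ : Site d → Fin d → Matrix n n ℂ) (α₀ : ℝ) (m : Site d → Fin d → ℝ) (C : ℝ),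
        IsSkewDir X₀ ∧
        (∀ (hWu : IsUnitaryCfg Us) (hx : 0 ≤ ε / ((L : ℝ) ^ (k + 1)) ^ 2) (hs : LevelSmall d L k (ε / ((L : ℝ) ^ (k + 1)) ^ 2))
            (hWx : SmallField Us (ε / ((L : ℝ) ^ (k + 1)) ^ 2))
            (hθ : cruxC d L * (((L : ℝ) ^ (k + 1)) ^ 2 * (ε / ((L : ℝ) ^ (k + 1)) ^ 2)) < 1)
            (hφ : IsSkewDir (dirIter L (k + 1) Us X₀)),
          ResidualSliceRepT L N (k + 1) Us U' u X₀ (rightInvW hL k hWu hx hs hWx N hθ hφ) α₀) ∧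
        (∀ z κ, 0 ≤ m z κ) ∧ 0 ≤ C ∧
        ((L : ℝ) ^ (k + 1)) ^ d * ∑ z ∈ periodBox (d := d) N, ∑ κ : Fin d, m z κ ^ 2
          ≤ C ^ 2 * dirSq X₀ (periodBox (d := d) (N * L ^ (k + 1))) ∧
        (∀ z ∈ periodBox (d := d) N, ∀ κ : Fin d, ‖dirIter L (k + 1) Us X₀ z κ‖ ≤ C₂ * ((L : ℝ) ^ (k + 1) * m z κ) ^ 2) ∧
        α₀ * (L : ℝ) ^ (k + 1) ≤ αh ∧ (∀ z κ, m z κ * (L : ℝ) ^ (k + 1) ≤ αh) ∧ C ≤ Ch) :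
    ∃ γ : ℝ, 0 < γ ∧ ∀ V : Site d → Fin d → (Matrix n n ℂ)ˣ, IsUnitaryCfg V → IsPeriodicCfg V (N : ℤ) → SmallField V γ →
      ∀ (k : ℕ) (U₀ : Site d → Fin d → (Matrix n n ℂ)ˣ), U₀ ∈ admissible (sfClass d L N ε) L (k + 1) V →
        SmallField U₀ (δ / ((L : ℝ) ^ k) ^ 2) →
        ∃ U, IsMinimiser d (sfClass d L N ε) L N (k + 1) V U ∧ SmallField U (δ / ((L : ℝ) ^ (k + 1)) ^ 2) := by
  -- the data class and the side conditions as a set and a predicate, for F30's binder form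
  let 𝒟 : Set (Site d → Fin d → (Matrix n n ℂ)ˣ) := {D | IsUnitaryCfg D ∧ IsPeriodicCfg D (N : ℤ) ∧ SmallField D (4 * (Real.exp β - 1))}
  let P : ℕ → (Site d → Fin d → (Matrix n n ℂ)ˣ) → (Site d → Fin d → (Matrix n n ℂ)ˣ) → Prop := fun k _ Us =>
    SmallField Us (δ₁ / ((L : ℝ) ^ (k + 1)) ^ 2) ∧
      ∀ φ : Site d → Fin d → Matrix n n ℂ, IsSkewDir φ → IsPeriodicDir φ ((N * L ^ (k + 1) : ℕ) : ℤ) → TangentIter L k Us φ →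
        dAction Us φ (perWin d (N * L ^ (k + 1))) = 0
  have hrep := hrep_of_hleaves (𝒟 := 𝒟) (P := P) (CP := CP) hL hε hls hθl hε1' hC₂ hαh0 hαh1 hCh0 hνh hκh hν hline
    (fun D hD k Us hUs hPk U' hU' => hleaves D hD.1 hD.2.1 hD.2.2 k Us hUs hPk.1 hPk.2 U' hU')
  exact oneStep_of_dataClass_ape_repWgauge hL hN hε.le hε1 hε2 hδ₁ hδ₁δ hδε hCP hβ hls hP hape
    (fun D hDu hDP hDs k Us hUs hsm hcrit U' hU' => hrep D ⟨hDu, hDP, hDs⟩ k Us hUs ⟨hsm, hcrit⟩ U' hU')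

/-! ## §2 `d = 4`, `L = 2`, SU(2): the END of record of generation 69 -/

/-- **ONE-STEP AT `d = 4`, `L = 2`, SU(2)∕U(2) (`card n = 2`), `0 < ε ≤ 10⁻⁵³`, FOR ALL `γ`-SMALL DATA ⇐ (APE) ∧ ROW NE3's `hleaves` ON `𝒟_β`**
((P♮)_W, the level family, the class smallness and `ε ≤ 1` DISCHARGED; displayed: the W6 regime `thetaLoc 4 2·ε < 1`, the ceilings, two k-free lines).
THE END OF RECORD of generation 69. [folklore] -/
theorem oneStep_SU2_of_dataClass_ape_routePi [Nonempty n] (hn : Fintype.card n = 2) {N : ℕ} [NeZero N] (hN : 1 ≤ N) {ε δ δ₁ β : ℝ}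
    (hε : 0 < ε) (hε' : ε ≤ 1 / 10 ^ 53) (hδ₁ : 0 ≤ δ₁) (hδ₁δ : δ₁ < δ) (hδε : δ < ε) (hβ : 0 < β)
    (hθl : thetaLoc 4 2 * ε < 1) {C₂ αh Ch : ℝ} (hC₂ : 0 ≤ C₂) (hαh0 : 0 ≤ αh) (hαh1 : αh ≤ 1) (hCh0 : 0 ≤ Ch)
    {νh κh : ℝ} (hνh : νh = 2 * Real.sqrt (l2C 4 2 / (1 - thetaLoc 4 2 * ε) ^ 2 + curl2C 4 2 / (1 - thetaLoc 4 2 * ε) ^ 2) * C₂ * Ch * αh)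
    (hκh : κh = 4 * (curl1C 4 2 / (1 - thetaLoc 4 2 * ε)) * C₂ * Ch ^ 2 * ε) (hν : νh < 1)
    (hline : 2 * (κh / (1 - νh) ^ 2) < ((((1 / 2 - (νh / (1 - νh)) ^ 2) / (2 * (1 + (CPLine 4 2 2 (1 / 10 ^ 17) (1 / 10 ^ 53) + 1)))
        - (νh / (1 - νh)) ^ 2) / 2 - 576 * (4 : ℕ) * (αh ^ 2 * Real.exp (2 * αh))) / (Fintype.card n : ℝ) - 28 * (4 : ℕ) * (ε + 7 * αh ^ 2)))
    (hape : ∀ D : Site 4 → Fin 4 → (Matrix n n ℂ)ˣ, IsUnitaryCfg D → IsPeriodicCfg D (N : ℤ) → SmallField D (4 * (Real.exp β - 1)) →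
      ∀ (k : ℕ), ∀ U ∈ admissible (sfClass 4 2 N ε) 2 (k + 1) D, SmallField U (δ / ((((2 : ℕ) : ℝ)) ^ (k + 1)) ^ 2) →
      (∀ φ : Site 4 → Fin 4 → Matrix n n ℂ, IsSkewDir φ → IsPeriodicDir φ ((N * 2 ^ (k + 1) : ℕ) : ℤ) → TangentIter 2 k U φ →
        dAction U φ (perWin 4 (N * 2 ^ (k + 1))) = 0) → SmallField U (δ₁ / ((((2 : ℕ) : ℝ)) ^ (k + 1)) ^ 2))
    (hleaves : ∀ D : Site 4 → Fin 4 → (Matrix n n ℂ)ˣ, IsUnitaryCfg D → IsPeriodicCfg D (N : ℤ) → SmallField D (4 * (Real.exp β - 1)) →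
      ∀ (k : ℕ), ∀ Us ∈ admissible (sfClass 4 2 N ε) 2 (k + 1) D, SmallField Us (δ₁ / ((((2 : ℕ) : ℝ)) ^ (k + 1)) ^ 2) →
      (∀ φ : Site 4 → Fin 4 → Matrix n n ℂ, IsSkewDir φ → IsPeriodicDir φ ((N * 2 ^ (k + 1) : ℕ) : ℤ) → TangentIter 2 k Us φ →
        dAction Us φ (perWin 4 (N * 2 ^ (k + 1))) = 0) →
      ∀ U' ∈ admissible (sfClass 4 2 N ε) 2 (k + 1) D,
      ∃ (u : Site 4 → (Matrix n n ℂ)ˣ) (X₀ : Site 4 → Fin 4 → Matrix n n ℂ) (α₀ : ℝ) (m : Site 4 → Fin 4 → ℝ) (C : ℝ),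
        IsSkewDir X₀ ∧
        (∀ (hWu : IsUnitaryCfg Us) (hx : 0 ≤ ε / ((((2 : ℕ) : ℝ)) ^ (k + 1)) ^ 2)
            (hs : LevelSmall 4 2 k (ε / ((((2 : ℕ) : ℝ)) ^ (k + 1)) ^ 2)) (hWx : SmallField Us (ε / ((((2 : ℕ) : ℝ)) ^ (k + 1)) ^ 2))
            (hθ : cruxC 4 2 * (((((2 : ℕ) : ℝ)) ^ (k + 1)) ^ 2 * (ε / ((((2 : ℕ) : ℝ)) ^ (k + 1)) ^ 2)) < 1)
            (hφ : IsSkewDir (dirIter 2 (k + 1) Us X₀)),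
          ResidualSliceRepT 2 N (k + 1) Us U' u X₀ (rightInvW (by norm_num) k hWu hx hs hWx N hθ hφ) α₀) ∧
        (∀ z κ, 0 ≤ m z κ) ∧ 0 ≤ C ∧
        ((((2 : ℕ) : ℝ)) ^ (k + 1)) ^ 4 * ∑ z ∈ periodBox (d := 4) N, ∑ κ : Fin 4, m z κ ^ 2
          ≤ C ^ 2 * dirSq X₀ (periodBox (d := 4) (N * 2 ^ (k + 1))) ∧
        (∀ z ∈ periodBox (d := 4) N, ∀ κ : Fin 4, ‖dirIter 2 (k + 1) Us X₀ z κ‖ ≤ C₂ * ((((2 : ℕ) : ℝ)) ^ (k + 1) * m z κ) ^ 2) ∧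
        α₀ * (((2 : ℕ) : ℝ)) ^ (k + 1) ≤ αh ∧ (∀ z κ, m z κ * (((2 : ℕ) : ℝ)) ^ (k + 1) ≤ αh) ∧ C ≤ Ch) :
    ∃ γ : ℝ, 0 < γ ∧ ∀ V : Site 4 → Fin 4 → (Matrix n n ℂ)ˣ, IsUnitaryCfg V → IsPeriodicCfg V (N : ℤ) → SmallField V γ →
      ∀ (k : ℕ) (U₀ : Site 4 → Fin 4 → (Matrix n n ℂ)ˣ), U₀ ∈ admissible (sfClass 4 2 N ε) 2 (k + 1) V →
        SmallField U₀ (δ / ((((2 : ℕ) : ℝ)) ^ k) ^ 2) →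
        ∃ U, IsMinimiser 4 (sfClass 4 2 N ε) 2 N (k + 1) V U ∧ SmallField U (δ / ((((2 : ℕ) : ℝ)) ^ (k + 1)) ^ 2) := by
  have hP0 := classSlicePoincare_SU2' (n := n) hn hN hε hε'
  have hCP : 0 < CPLine 4 2 2 (1 / 10 ^ 17) (1 / 10 ^ 53) + 1 := by linarith [CPLine_nonneg_d4_L2]
  have hP : ∀ (j : ℕ) (W : Site 4 → Fin 4 → (Matrix n n ℂ)ˣ), W ∈ sfClass 4 2 N ε (j + 1) →
      SlicePoincare 2 (j + 1) W (frameFreeBlockLandauW 2 N (j + 1) W) (CPLine 4 2 2 (1 / 10 ^ 17) (1 / 10 ^ 53) + 1)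
        (periodBox (d := 4) (N * 2 ^ (j + 1))) :=
    fun j W hW => slicePoincare_mono (hP0 j W hW) (by linarith)
  have hls := levelSmall_all_d4_L2 hε.le (hε'.trans (by norm_num))
  obtain ⟨hε1, hε2⟩ := classSmall_d4_L2 hε'
  have hε1' : ε ≤ 1 := hε'.trans (by norm_num)
  exact oneStep_of_dataClass_ape_routePi (by norm_num) hN hε hε1 hε2 hδ₁ hδ₁δ hδε hCP hβ hls hP hθl hε1' hC₂ hαh0 hαh1 hCh0 hνh hκh hν
    hline hape hleaves

end

end Summit.QuantumFields.BalabanUV.T4Continuum.NE7OneStepOfRoutePi
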